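import Literature.NumberTheory.GaloisRepresentations.ContinuousShapiroLiftMackeyH1
import HarnessLib

/-!
# The S₀-MACKEY PACKAGE GLUE of item 7 (`stub_deepHalfAwayTwo`): levelwise existence with PRESCRIBED orbit components from
# (R1) joint surjectivity, (R2) orbit splitting, the two `⟹` dictionaries and ONE `SelmerComplement` call — abstract bookkeeping, PROVED

Route `ResidualThetaTransportAtTwo` (RTT), crux RSL_g `ResidualSignedLambdaLowerCMAtTwo` (stmt-BirchSwinnertonDyer-22608); seat
`prover-bsd-wall-tp2-p2x` g17 (`--supports 22608 --as helper`, closes nothing). THEOREMS ONLY (no definition, no named fact, no instance,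
no `sorry`). This is §A of the ADOPTED card `Ideas/stub-cmlambdalower-k3-g11.md` (STUB-PLAN rev 16 §0.1, S66; credit sidea k3 g11), transcribed
so that the item-7 module (Q67) can call it BY NAME; its §B (the generic engines R1/R2) is `Literature/…/ContinuousShapiroLiftMackeyH1.lean`
(p685176/p686068) and the arbitrary-second-factor local term is `CyclotomicLayer.invAt_cupProduct_map_shapiroLift_eq_sum` (p686589).

Dictionary (level `n`, modulus `2^k`, `Λ = S₀`, `ι ℓ` = the `Γ_{ℚ_ℓ}`-orbits on `Γ_ℚ ⧸ Γ_n` = the primes of `ℚ_n` above `ℓ`): `Sh` = global Shapiro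
lift (onto), `ShD` = `H¹(Ψ) ∘ Sh` on the dual side (onto `H¹(ℚ, Maps^D)`: `CoindShapiroOfFun.existsUnique_shapiroLift_coindTateDual_eq`),
`locG ℓ` / `locD ℓ` = localisations, `comp ℓ i a = θ_N^*(g_i · a)` (orbit components), `πd ℓ i` = orbit projection on LOCAL dual classes with
`hπd` its compatibility with `ShD`, `P ℓ` = local Tate pairing of `Maps(Γ ⧸ Γ_n, A[2^k])` at `ℓ`, `p ℓ` = the layer pairing at the place
`(ℓ, g_i)`, `hsplit` = (R2) (`cupProduct_map_shapiroLift_eq_sum_orbits` / Q69), `hR1` = (R1) (`exists_cohomologyMap_resCoindFinHomR_eq`),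
`hdict`/`hdictT` = the `⟹` dictionaries (`ShapiroTransport.*`), `hSC` = `SelmerComplement` (ii) with `IsPerfect` folded in, `hyp` = the item's
orthogonality hypothesis; conclusion = a good `T`-side class at level `n` with the prescribed components (= a point of `Sol(n,k)`, i.e. `hne`).

References: [Brown1982] III §5 (5.6)(b); [NeukirchSchmidtWingberg2008] I §6 Prop. (1.6.4)–(1.6.5); [MilneADT2006] I Thm. 4.10 (Poitou–Tate).
BSD is not proved by any of this; RSL_g is not proved here.
-/

set_option autoImplicit false
-- the Theorems namespace of this sub repeats the summit name by design (D-0017 nested layout)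
set_option linter.dupNamespace false

namespace Summit.BirchSwinnertonDyer.BirchSwinnertonDyer.Theorems.ThetaTransport.MackeyPackage

open scoped BigOperators

variable {Λ : Type*} [Fintype Λ]
variable {ι : Λ → Type*} [∀ l, Fintype (ι l)]
variable {Hn HT HG HGd Q : Type*} [AddCommMonoid Q]
variable {C Cd Lg Ld : Λ → Type*}

/-- **Levelwise existence from the S₀-Mackey package** (abstract glue, card k3-g11 §A): from the joint surjectivity of the orbit projections
on local dual classes (`hR1`), the orbit splitting of the local term (`hsplit`), the two `⟹` dictionaries (`hdict`, `hdictT`), ONE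
`SelmerComplement` (ii) call (`hSC`) and the item's orthogonality hypothesis (`hyp`), there is a good `T`-side class with the PRESCRIBED orbit
components `t`. Proof: choose local classes `u ℓ` with components `t ℓ` (R1); the orthogonality of `u` to the Selmer side is `hyp` read through
`hsplit`; `SelmerComplement` gives a dual-side global class `y = ShD x` with `locD ℓ y = u ℓ`; its components are the `t ℓ i` by `hπd`.
[cite: MilneADT2006, Ch. I Thm. 4.10] [cite: NeukirchSchmidtWingberg2008, I §6 Prop. (1.6.4)–(1.6.5)] [cite: Brown1982, III §5 (5.6)(b)] -/
theorem levelwise_exists_of_mackeyPackage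
    (Sh : Hn → HG) (hSh : Function.Surjective Sh)
    (ShD : HT → HGd) (hShD : Function.Surjective ShD)
    (locG : ∀ l, HG → Lg l) (locD : ∀ l, HGd → Ld l)
    (comp : ∀ l, ι l → Hn → C l) (compT : ∀ l, ι l → HT → Cd l)
    (πd : ∀ l, ι l → Ld l → Cd l) (hπd : ∀ l i x, πd l i (locD l (ShD x)) = compT l i x)
    (P : ∀ l, Lg l → Ld l → Q) (p : ∀ l, C l → Cd l → Q)
    (hsplit : ∀ l a u, P l (locG l (Sh a)) u = ∑ i, p l (comp l i a) (πd l i u))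
    (hR1 : ∀ l (t : ι l → Cd l), ∃ u : Ld l, ∀ i, πd l i u = t i)
    (good : Hn → Prop) (SelG : HG → Prop) (hdict : ∀ a, SelG (Sh a) → good a)
    (goodT : HT → Prop) (SelFd : HGd → Prop) (hdictT : ∀ x, SelFd (ShD x) → goodT x)
    (hSC : ∀ u : (∀ l, Ld l), (∀ x', SelG x' → ∑ l, P l (locG l x') (u l) = 0) →
      ∃ y, SelFd y ∧ ∀ l, locD l y = u l)
    (t : ∀ l, ι l → Cd l) (hyp : ∀ a, good a → ∑ l, ∑ i, p l (comp l i a) (t l i) = 0) :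
    ∃ x : HT, goodT x ∧ ∀ l i, compT l i x = t l i := by
  classical
  choose u hu using fun l => hR1 l (t l)
  obtain ⟨y, hyF, hyloc⟩ := hSC u (fun x' hx' => by
    obtain ⟨a, rfl⟩ := hSh x'
    have ha : good a := hdict a hx'
    calc ∑ l, P l (locG l (Sh a)) (u l) = ∑ l, ∑ i, p l (comp l i a) (πd l i (u l)) :=
          Finset.sum_congr rfl (fun l _ => hsplit l a (u l))
      _ = ∑ l, ∑ i, p l (comp l i a) (t l i) :=
          Finset.sum_congr rfl (fun l _ => Finset.sum_congr rfl (fun i _ => by rw [hu]))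
      _ = 0 := hyp a ha)
  obtain ⟨x, rfl⟩ := hShD y
  exact ⟨x, hdictT x hyF, fun l i => by rw [← hπd l i x, hyloc l, hu]⟩

/-- **One orbit everywhere** (e.g. every `ℓ ∈ S₀` inert in `ℚ_n`, or level `n = 0`): with `ι ℓ = Unit`, `Hn = HG`, `Sh = id`, components =
localisations and `p = P`, the package collapses to a plain `SelmerComplement` (ii) call read back on `HT`.
[cite: MilneADT2006, Ch. I Thm. 4.10] -/
theorem levelwise_exists_of_selmerComplement_oneOrbit (ShD : HT → HGd) (hShD : Function.Surjective ShD)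
    (locG : ∀ l, HG → Lg l) (locD : ∀ l, HGd → Ld l) (P : ∀ l, Lg l → Ld l → Q)
    (SelG : HG → Prop) (goodT : HT → Prop) (SelFd : HGd → Prop) (hdictT : ∀ x, SelFd (ShD x) → goodT x)
    (hSC : ∀ u : (∀ l, Ld l), (∀ x', SelG x' → ∑ l, P l (locG l x') (u l) = 0) →
      ∃ y, SelFd y ∧ ∀ l, locD l y = u l)
    (t : ∀ l : Λ, Unit → Ld l) (hyp : ∀ a, SelG a → ∑ l, ∑ i, P l (locG l a) (t l i) = 0) :
    ∃ x : HT, goodT x ∧ ∀ l i, locD l (ShD x) = t l i :=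
  levelwise_exists_of_mackeyPackage (ι := fun _ => Unit) id Function.surjective_id ShD hShD locG locD
    (fun l _ => locG l) (fun l _ x => locD l (ShD x)) (fun _ _ => id) (fun _ _ _ => rfl) P P
    (fun l a u => by simp) (fun l t => ⟨t (), fun i => rfl⟩) SelG SelG (fun _ h => h) goodT SelFd hdictT hSC t hyp

end Summit.BirchSwinnertonDyer.BirchSwinnertonDyer.Theorems.ThetaTransport.MackeyPackage
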